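import Summits.Ventures.CertifiedManyBodySolver.Upper.StripCells

/-!
# The open Hubbard strip in column-major order, II: the inter-cell Jordan–Wigner words

HONEST FRAMING: first certified bounds; not a superconductivity verdict; every number certified or
labelled float.

Venture `Ventures/CertifiedManyBodySolver` (sr-mbsolver), K1-GATE «writer (ii)» piece (α), STRIP PART 2/3
(part 1: `Upper/StripCells.lean`). In the column-major Jordan–Wigner order the hopping word of the bond
`((c-1, y₀) of cell b) — ((0, y₀) of cell b+1)` carries the string `F` on the sites strictly between its
ends: the LATER rows `y₀ < y` of the last column of cell `b` and the EARLIER rows `y < y₀` of the first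
column of cell `b + 1` — all inside the two cells. This file computes the two halves:

* `stringFamily_of_lt`, `stringFamily_self_left/_right`, `stringFamily_comm`, `jwWordFamily_apply_of_ne_left/
  _right` — values of the word families of `Upper/SuperSiteBlocking.lean`;
* `interLeftFamily hc y₀ M` (`M` at `(c-1, y₀)`, `F` at `(c-1, y)` for `y₀ < y`), `interRightFamily hc y₀ M`
  (`M` at `(0, y₀)`, `F` at `(0, y)` for `y < y₀`);
* `jwWordFamily_inter_left/_right` (forward hop `c†_x c_y`: halves `interLeftFamily (c†_σ F)`,
  `interRightFamily c_σ`), `jwWordFamily_inter_left'/_right'` (backward hop `c†_y c_x`: halves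
  `interLeftFamily (F c_σ)`, `interRightFamily c†_σ`), `jwWordFamily_inter_eq_one` (trivial off the two cells);
* **`superOp_productOp_jwWordFamily_inter` / `_inter'`** — an inter-cell word blocks to
  `onSite b (superSite L) * onSite b' (superSite R)` on the cell chain.

Part 3 (`Upper/StripCellHamiltonian.lean`) assembles the blocked Hamiltonian. References: Essler et al.
(2005) §12.3.4 eqs. (12.198)–(12.201) (Jordan–Wigner strings, as typed in `HubbardJordanWigner.lean`).
-/

noncomputable section

open Matrix Finset
open scoped ComplexOrder BigOperators Kronecker

namespace Summit.Ventures.CertifiedManyBodySolver.Upper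

open Literature.MathematicalPhysics.QuantumLattice
open Literature.MathematicalPhysics.QuantumLattice.JordanWigner

/-! ### The inter-cell hopping words -/

section InterWords

variable {C c W Q : ℕ}

/-- Value of a hopping-word family off its right end `y`. -/
theorem jwWordFamily_apply_of_ne_right {Λ : Type*} [LinearOrder Λ] {x y z : Λ} (hz : z ≠ y)
    (A B : Matrix (Fin 4) (Fin 4) ℂ) :
    jwWordFamily x y A B z = if z = x then A * stringFamily x y x else stringFamily x y z := by
  rw [jwWordFamily, Function.update_of_ne hz, Function.update_apply]

/-- Value of a hopping-word family off its left end `x`. -/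
theorem jwWordFamily_apply_of_ne_left {Λ : Type*} [LinearOrder Λ] {x y z : Λ} (hz : z ≠ x)
    (A B : Matrix (Fin 4) (Fin 4) ℂ) :
    jwWordFamily x y A B z = if z = y then stringFamily x y y * B else stringFamily x y z := by
  rw [jwWordFamily, Function.update_apply, Function.update_of_ne hz]

/-- The string family for `x < y`: the parity on `[x, y)`. -/
theorem stringFamily_of_lt {Λ : Type*} [LinearOrder Λ] {x y : Λ} (hxy : x < y) (z : Λ) :
    stringFamily x y z = if x ≤ z ∧ z < y then siteParity else 1 := by
  unfold stringFamily
  by_cases h : x ≤ z ∧ z < y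
  · rw [if_pos (Or.inl h), if_pos h]
  · rw [if_neg h, if_neg]
    rintro (h' | h')
    · exact h h'
    · exact absurd (lt_trans (lt_of_le_of_lt h'.1 h'.2) hxy) (lt_irrefl _)

/-- The string family is symmetric in its two ends. -/
theorem stringFamily_comm {Λ : Type*} [LinearOrder Λ] (x y z : Λ) :
    stringFamily y x z = stringFamily x y z :=
  if_congr or_comm rfl rfl

/-- The string family for `x < y`, ends exchanged. -/
theorem stringFamily_of_lt' {Λ : Type*} [LinearOrder Λ] {x y : Λ} (hxy : x < y) (z : Λ) :
    stringFamily y x z = if x ≤ z ∧ z < y then siteParity else 1 := by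
  rw [stringFamily_comm, stringFamily_of_lt hxy]

/-- At its lower end the string carries the parity. -/
theorem stringFamily_self_left {Λ : Type*} [LinearOrder Λ] {x y : Λ} (hxy : x < y) :
    stringFamily x y x = siteParity := by
  rw [stringFamily_of_lt hxy, if_pos ⟨le_rfl, hxy⟩]

/-- At its upper end the string carries the identity. -/
theorem stringFamily_self_right {Λ : Type*} [LinearOrder Λ] {x y : Λ} (hxy : x < y) :
    stringFamily x y y = 1 := by
  rw [stringFamily_of_lt hxy, if_neg (fun h => lt_irrefl _ h.2)]

/-- The LEFT half of an inter-cell hopping word, on the sites `Fin c ×ₗ Fin W` of a cell: on the last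
column `c - 1`, the matrix `M` at row `y₀` and the parity `F` at the later rows `y₀ < y`; the identity
elsewhere. -/
def interLeftFamily (hc : 0 < c) (y₀ : Fin W) (M : Matrix (Fin 4) (Fin 4) ℂ) :
    (Fin c ×ₗ Fin W) → Matrix (Fin 4) (Fin 4) ℂ := fun f =>
  if (ofLex f).1 = ⟨c - 1, by omega⟩ then
    (if (ofLex f).2 = y₀ then M else if y₀ < (ofLex f).2 then siteParity else 1)
  else 1

/-- The RIGHT half of an inter-cell hopping word: on the first column `0` of the cell, the matrix `M` at
row `y₀` and the parity `F` at the earlier rows `y < y₀`; the identity elsewhere. -/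
def interRightFamily (hc : 0 < c) (y₀ : Fin W) (M : Matrix (Fin 4) (Fin 4) ℂ) :
    (Fin c ×ₗ Fin W) → Matrix (Fin 4) (Fin 4) ℂ := fun f =>
  if (ofLex f).1 = ⟨0, hc⟩ then
    (if (ofLex f).2 = y₀ then M else if (ofLex f).2 < y₀ then siteParity else 1)
  else 1

/-- Sites of an earlier cell precede sites of a later cell. -/
theorem stripCells_symm_lt_of_lt {b b' : Fin C} (hbb' : b < b') (f f' : Fin c ×ₗ Fin W) :
    (stripCells C c W).symm (b, f) < (stripCells C c W).symm (b', f') := by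
  rw [stripCells_symm_apply, stripCells_symm_apply, Prod.Lex.toLex_lt_toLex]
  left
  rw [Fin.lt_def, finProdFinEquiv_apply_val, finProdFinEquiv_apply_val]
  have h₁ : c * ((b : ℕ) + 1) ≤ c * b' := Nat.mul_le_mul_left c hbb'
  rw [mul_add_one] at h₁
  have := (ofLex f).1.isLt
  dsimp only
  omega

/-- Two sites of the strip coincide iff their cells and cell positions do. -/
theorem stripCells_symm_eq_iff (b b' : Fin C) (f f' : Fin c ×ₗ Fin W) :
    (stripCells C c W).symm (b, f) = (stripCells C c W).symm (b', f') ↔ b = b' ∧ f = f' := by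
  rw [(stripCells C c W).symm.apply_eq_iff_eq, Prod.mk.injEq]

/-- Sites of one cell compare strictly as their cell positions. -/
theorem stripCells_symm_lt_iff (b : Fin C) (f f' : Fin c ×ₗ Fin W) :
    (stripCells C c W).symm (b, f) < (stripCells C c W).symm (b, f') ↔ f < f' :=
  (cellEmb C c W b).lt_iff_lt

/-- **The forward inter-cell word on the left cell** (`b + 1 = b'`, bond `((c-1, y₀) of b) → ((0, y₀) of b')`):
restricted to cell `b`, the family of `A_x · F_x F_y · B_y` is `interLeftFamily hc y₀ (A F)`. -/
theorem jwWordFamily_inter_left (hc : 0 < c) {b b' : Fin C} (hbb' : (b : ℕ) + 1 = b') (y₀ : Fin W)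
    (A B : Matrix (Fin 4) (Fin 4) ℂ) (f : Fin c ×ₗ Fin W) :
    jwWordFamily ((stripCells C c W).symm (b, toLex (⟨c - 1, by omega⟩, y₀)))
        ((stripCells C c W).symm (b', toLex (⟨0, hc⟩, y₀))) A B ((stripCells C c W).symm (b, f)) =
      interLeftFamily hc y₀ (A * siteParity) f := by
  have hb : b < b' := by rw [Fin.lt_def]; omega
  have hxy := stripCells_symm_lt_of_lt hb (toLex (⟨c - 1, by omega⟩, y₀)) (toLex ((⟨0, hc⟩ : Fin c), y₀))
  have hzy := stripCells_symm_lt_of_lt hb f (toLex ((⟨0, hc⟩ : Fin c), y₀))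
  rw [jwWordFamily_apply_of_ne_right hzy.ne, stringFamily_self_left hxy, stringFamily_of_lt hxy]
  obtain ⟨⟨j, y⟩, rfl⟩ := toLex.surjective f
  unfold interLeftFamily
  simp only [stripCells_symm_eq_iff, stripCells_symm_le_iff, true_and, hzy, and_true, ofLex_toLex,
    toLex_inj, Prod.mk.injEq, Prod.Lex.toLex_le_toLex]
  by_cases hj : j = ⟨c - 1, by omega⟩
  · subst hj
    by_cases hy : y = y₀
    · subst hy; simp
    · have hy' : ¬ ((⟨c - 1, by omega⟩ : Fin c) < ⟨c - 1, by omega⟩) := lt_irrefl _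
      simp only [hy, and_false, if_false, hy', false_or, true_and, if_true]
      by_cases hlt : y₀ < y
      · rw [if_pos hlt.le, if_pos hlt]
      · rw [if_neg hlt, if_neg]
        intro hle
        exact hlt (lt_of_le_of_ne hle (Ne.symm hy))
  · have hj' : ¬ ((⟨c - 1, by omega⟩ : Fin c) < j) := by
      rw [Fin.lt_def]; have := j.isLt; dsimp only; omega
    have hj'' : ¬ ((⟨c - 1, by omega⟩ : Fin c) = j) := fun h => hj h.symm
    simp only [hj, false_and, if_false, hj', hj'', false_or]

/-- **The forward inter-cell word on the right cell**: restricted to cell `b'`, the family is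
`interRightFamily hc y₀ B`. -/
theorem jwWordFamily_inter_right (hc : 0 < c) {b b' : Fin C} (hbb' : (b : ℕ) + 1 = b') (y₀ : Fin W)
    (A B : Matrix (Fin 4) (Fin 4) ℂ) (f : Fin c ×ₗ Fin W) :
    jwWordFamily ((stripCells C c W).symm (b, toLex (⟨c - 1, by omega⟩, y₀)))
        ((stripCells C c W).symm (b', toLex (⟨0, hc⟩, y₀))) A B ((stripCells C c W).symm (b', f)) =
      interRightFamily hc y₀ B f := by
  have hb : b < b' := by rw [Fin.lt_def]; omega
  have hxy := stripCells_symm_lt_of_lt hb (toLex (⟨c - 1, by omega⟩, y₀)) (toLex ((⟨0, hc⟩ : Fin c), y₀))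
  have hxz := stripCells_symm_lt_of_lt hb (toLex (⟨c - 1, by omega⟩, y₀)) f
  rw [jwWordFamily_apply_of_ne_left hxz.ne', stringFamily_self_right hxy, Matrix.one_mul,
    stringFamily_of_lt hxy]
  obtain ⟨⟨j, y⟩, rfl⟩ := toLex.surjective f
  unfold interRightFamily
  simp only [stripCells_symm_eq_iff, stripCells_symm_lt_iff, true_and, hxz.le, ofLex_toLex, toLex_inj,
    Prod.mk.injEq, Prod.Lex.toLex_lt_toLex]
  by_cases hj : j = ⟨0, hc⟩
  · subst hj
    by_cases hy : y = y₀
    · subst hy; simp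
    · have hy' : ¬ ((⟨0, hc⟩ : Fin c) < ⟨0, hc⟩) := lt_irrefl _
      simp only [hy, and_false, if_false, hy', false_or, true_and, if_true]
      exact if_congr Iff.rfl rfl rfl
  · have hj' : ¬ (j < (⟨0, hc⟩ : Fin c)) := by rw [Fin.lt_def]; simp
    simp only [hj, false_and, if_false, hj', false_or]

/-- **The backward inter-cell word on the left cell** (bond `((0, y₀) of b') → ((c-1, y₀) of b)`): restricted
to cell `b`, the family of `A_y · F_y F_x · B_x` is `interLeftFamily hc y₀ (F B)`. -/
theorem jwWordFamily_inter_left' (hc : 0 < c) {b b' : Fin C} (hbb' : (b : ℕ) + 1 = b') (y₀ : Fin W)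
    (A B : Matrix (Fin 4) (Fin 4) ℂ) (f : Fin c ×ₗ Fin W) :
    jwWordFamily ((stripCells C c W).symm (b', toLex (⟨0, hc⟩, y₀)))
        ((stripCells C c W).symm (b, toLex (⟨c - 1, by omega⟩, y₀))) A B ((stripCells C c W).symm (b, f)) =
      interLeftFamily hc y₀ (siteParity * B) f := by
  have hb : b < b' := by rw [Fin.lt_def]; omega
  have hxy := stripCells_symm_lt_of_lt hb (toLex (⟨c - 1, by omega⟩, y₀)) (toLex ((⟨0, hc⟩ : Fin c), y₀))
  have hzy := stripCells_symm_lt_of_lt hb f (toLex ((⟨0, hc⟩ : Fin c), y₀))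
  rw [jwWordFamily_apply_of_ne_left hzy.ne, stringFamily_comm, stringFamily_self_left hxy,
    stringFamily_of_lt' hxy]
  obtain ⟨⟨j, y⟩, rfl⟩ := toLex.surjective f
  unfold interLeftFamily
  simp only [stripCells_symm_eq_iff, stripCells_symm_le_iff, true_and, hzy, and_true, ofLex_toLex,
    toLex_inj, Prod.mk.injEq, Prod.Lex.toLex_le_toLex]
  by_cases hj : j = ⟨c - 1, by omega⟩
  · subst hj
    by_cases hy : y = y₀
    · subst hy; simp
    · have hy' : ¬ ((⟨c - 1, by omega⟩ : Fin c) < ⟨c - 1, by omega⟩) := lt_irrefl _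
      simp only [hy, and_false, if_false, hy', false_or, true_and, if_true]
      by_cases hlt : y₀ < y
      · rw [if_pos hlt.le, if_pos hlt]
      · rw [if_neg hlt, if_neg]
        intro hle
        exact hlt (lt_of_le_of_ne hle (Ne.symm hy))
  · have hj' : ¬ ((⟨c - 1, by omega⟩ : Fin c) < j) := by
      rw [Fin.lt_def]; have := j.isLt; dsimp only; omega
    have hj'' : ¬ ((⟨c - 1, by omega⟩ : Fin c) = j) := fun h => hj h.symm
    simp only [hj, false_and, if_false, hj', hj'', false_or]

/-- **The backward inter-cell word on the right cell**: restricted to cell `b'`, the family is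
`interRightFamily hc y₀ A`. -/
theorem jwWordFamily_inter_right' (hc : 0 < c) {b b' : Fin C} (hbb' : (b : ℕ) + 1 = b') (y₀ : Fin W)
    (A B : Matrix (Fin 4) (Fin 4) ℂ) (f : Fin c ×ₗ Fin W) :
    jwWordFamily ((stripCells C c W).symm (b', toLex (⟨0, hc⟩, y₀)))
        ((stripCells C c W).symm (b, toLex (⟨c - 1, by omega⟩, y₀))) A B ((stripCells C c W).symm (b', f)) =
      interRightFamily hc y₀ A f := by
  have hb : b < b' := by rw [Fin.lt_def]; omega
  have hxy := stripCells_symm_lt_of_lt hb (toLex (⟨c - 1, by omega⟩, y₀)) (toLex ((⟨0, hc⟩ : Fin c), y₀))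
  have hxz := stripCells_symm_lt_of_lt hb (toLex (⟨c - 1, by omega⟩, y₀)) f
  rw [jwWordFamily_apply_of_ne_right hxz.ne', stringFamily_comm, stringFamily_self_right hxy,
    Matrix.mul_one, stringFamily_of_lt' hxy]
  obtain ⟨⟨j, y⟩, rfl⟩ := toLex.surjective f
  unfold interRightFamily
  simp only [stripCells_symm_eq_iff, stripCells_symm_lt_iff, true_and, hxz.le, ofLex_toLex, toLex_inj,
    Prod.mk.injEq, Prod.Lex.toLex_lt_toLex]
  by_cases hj : j = ⟨0, hc⟩
  · subst hj
    by_cases hy : y = y₀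
    · subst hy; simp
    · have hy' : ¬ ((⟨0, hc⟩ : Fin c) < ⟨0, hc⟩) := lt_irrefl _
      simp only [hy, and_false, if_false, hy', false_or, true_and, if_true]
      exact if_congr Iff.rfl rfl rfl
  · have hj' : ¬ (j < (⟨0, hc⟩ : Fin c)) := by rw [Fin.lt_def]; simp
    simp only [hj, false_and, if_false, hj', false_or]

/-- An inter-cell word is trivial off the two cells it joins. -/
theorem jwWordFamily_inter_eq_one (hc : 0 < c) {b b' : Fin C} (hbb' : (b : ℕ) + 1 = b') (y₀ : Fin W)
    (A B : Matrix (Fin 4) (Fin 4) ℂ) {z : Fin (C * c) ×ₗ Fin W} (hz : (stripCells C c W z).1 ≠ b)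
    (hz' : (stripCells C c W z).1 ≠ b') :
    jwWordFamily ((stripCells C c W).symm (b, toLex (⟨c - 1, by omega⟩, y₀)))
        ((stripCells C c W).symm (b', toLex (⟨0, hc⟩, y₀))) A B z = 1 ∧
      jwWordFamily ((stripCells C c W).symm (b', toLex (⟨0, hc⟩, y₀)))
        ((stripCells C c W).symm (b, toLex (⟨c - 1, by omega⟩, y₀))) A B z = 1 := by
  have hb : b < b' := by rw [Fin.lt_def]; omega
  have hxy := stripCells_symm_lt_of_lt hb (toLex (⟨c - 1, by omega⟩, y₀)) (toLex ((⟨0, hc⟩ : Fin c), y₀))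
  have hzx : z ≠ (stripCells C c W).symm (b, toLex (⟨c - 1, by omega⟩, y₀)) := by
    rintro rfl; exact hz (by rw [Equiv.apply_symm_apply])
  have hzy : z ≠ (stripCells C c W).symm (b', toLex (⟨0, hc⟩, y₀)) := by
    rintro rfl; exact hz' (by rw [Equiv.apply_symm_apply])
  have hstr : stringFamily ((stripCells C c W).symm (b, toLex (⟨c - 1, by omega⟩, y₀)))
      ((stripCells C c W).symm (b', toLex (⟨0, hc⟩, y₀))) z = 1 := by
    rw [stringFamily_of_lt hxy, if_neg]
    rintro ⟨h₁, h₂⟩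
    rcases stripCells_fst_of_between hbb' _ _ h₁ h₂.le with h | h
    · exact hz h
    · exact hz' h
  constructor
  · rw [jwWordFamily_apply_of_ne_right hzy, if_neg hzx, hstr]
  · rw [jwWordFamily_apply_of_ne_right hzx, if_neg hzy, stringFamily_comm, hstr]

/-- **Blocking the forward inter-cell word**: `superOp (A_x · F_x F_y · B_y) = (L)_b (R)_{b'}` with
`L = superSite (⨂ interLeftFamily y₀ (A F))`, `R = superSite (⨂ interRightFamily y₀ B)`. -/
theorem superOp_productOp_jwWordFamily_inter (hc : 0 < c) (κ : TensorIndex (Fin c ×ₗ Fin W) 4 ≃ Fin Q)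
    {b b' : Fin C} (hbb' : (b : ℕ) + 1 = b') (y₀ : Fin W) (A B : Matrix (Fin 4) (Fin 4) ℂ) :
    superOp (stripCells C c W) κ (productOp (jwWordFamily
        ((stripCells C c W).symm (b, toLex (⟨c - 1, by omega⟩, y₀)))
        ((stripCells C c W).symm (b', toLex (⟨0, hc⟩, y₀))) A B)) =
      onSite b (superSite κ (productOp (interLeftFamily hc y₀ (A * siteParity)))) *
        onSite b' (superSite κ (productOp (interRightFamily hc y₀ B))) := by
  have hne : b ≠ b' := fun h => by rw [Fin.ext_iff] at h; omega
  rw [superOp_productOp_of_support₂ (stripCells C c W) κ _ hne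
    (fun z hz hz' => (jwWordFamily_inter_eq_one hc hbb' y₀ A B hz hz').1)]
  simp only [jwWordFamily_inter_left hc hbb', jwWordFamily_inter_right hc hbb']

/-- **Blocking the backward inter-cell word**: `superOp (A_y · F_y F_x · B_x) = (L')_b (R')_{b'}` with
`L' = superSite (⨂ interLeftFamily y₀ (F B))`, `R' = superSite (⨂ interRightFamily y₀ A)`. -/
theorem superOp_productOp_jwWordFamily_inter' (hc : 0 < c) (κ : TensorIndex (Fin c ×ₗ Fin W) 4 ≃ Fin Q)
    {b b' : Fin C} (hbb' : (b : ℕ) + 1 = b') (y₀ : Fin W) (A B : Matrix (Fin 4) (Fin 4) ℂ) :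
    superOp (stripCells C c W) κ (productOp (jwWordFamily
        ((stripCells C c W).symm (b', toLex (⟨0, hc⟩, y₀)))
        ((stripCells C c W).symm (b, toLex (⟨c - 1, by omega⟩, y₀))) A B)) =
      onSite b (superSite κ (productOp (interLeftFamily hc y₀ (siteParity * B)))) *
        onSite b' (superSite κ (productOp (interRightFamily hc y₀ A))) := by
  have hne : b ≠ b' := fun h => by rw [Fin.ext_iff] at h; omega
  rw [superOp_productOp_of_support₂ (stripCells C c W) κ _ hne
    (fun z hz hz' => (jwWordFamily_inter_eq_one hc hbb' y₀ A B hz hz').2)]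
  simp only [jwWordFamily_inter_left' hc hbb', jwWordFamily_inter_right' hc hbb']

end InterWords

end Summit.Ventures.CertifiedManyBodySolver.Upper

end
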